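import Mathlib.RingTheory.PowerSeries.Inverse
import Mathlib.Tactic
import HarnessLib

/-!
# Class O1 (X5, `p = 2`, non-CM): LEMMA K₂♮, sign fact S3 — Kobayashi's logarithm at `p = 2`
# in the UNIT variable, its Coleman norm relation at every finite level, and the torsion
# evaluation dictionary (typer queue v3.16 item (30), refuter spec REFUTER-O1 §104)

HONEST FRAMING (cell `b2b-bsdres`, run/shared/lean/b2b/bsd-rank1-residual/, verbatim in every
file): the goal of the cell is to DELETE the COMBINATION-SHAPED residual classes of the
Birch–Swinnerton-Dyer formula for ALL analytic-rank `≤ 1` elliptic curves over `ℚ` — "full BSD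
formula for every rank `≤ 1` curve in class `C`" assembled STRICTLY from published theorems — so
that the rank-`≤ 1` remainder becomes exactly the CONSTRUCTION-SHAPED classes, which are TYPED
(missing-input `Prop`s), NOT attempted. This is not "finishing BSD". Research routes; no claim
beyond stated classes; census output = EVIDENCE, never a Literature fact; nothing here is booked;
no mark of RESIDUAL-MAP §I moves.

Unit `b2b-bsdres-cc-typer-4` (lane CLASS-CLOSURE, class O1), gen 8; o1 lead PLAN §33 C199 (e) typer
queue v3.16 item **(30) RELEASED-OPTIONAL** "type S3 as the power-series identity
`G₂(X)·G₂(−2−X) = G₂(X²+2X)` (`G₂ = e⁴·exp(h)`, `h = ℓ₂ − log(1+X)`) plus the evaluation dictionary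
`N_{k_n/k_{n−1}} d_n = d_{n−1}` — NOT as an `∃`-statement over 'a norm-coherent system'" (o1 refuter
GEN 14 v14b §104 (6″) PASS of lens-3 GEN 19's LEMMA K₂ packet, `cells/o1/ROUTES-O1.md` (G19.2) /
(G19.3) / (G19.8)). Records-grade; no door effect; the KIM₂ door price and R-G21.2 (ii) "not in
print at `p = 2`" are UNCHANGED. THEOREMS over explicit ring elements + two `def`s with bodies and
one auxiliary unit; 0 named facts; nothing about any curve, field tower or Coleman map asserted.

## The printed source and its `p = 2` transposition

[Kobayashi 2006, §2, pp. 568–569] (odd `p`, `Δ = μ_{p−1}`): `ℓ(X) = log(1+X) + Σ_{k≥0} Σ_{δ∈Δ}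
((X+1)^{p^kδ} − 1)/p^k` ("convergent in `ℚ_p⟦X⟧` due to the summation `Σ_{δ∈Δ}`"),
`log_p(d_n) = ℓ(ε) + ℓ(ζ_{p^{n+1}} − 1) = p + Σ_{k=0}^{n} Σ_δ (ζ_{p^{n+1−k}}^δ − 1)/p^k`, and
Prop. 2.1 (i) "`(d_n)_n` is a norm compatible system … it suffices to show the trace compatibility
of `(log_p(d_n))_n`, and this is done by direct calculations." lens-3 GEN 19 (DERIVATION,
refuter-concurred) transposes this to `p = 2`: `Δ = {±1}`, `ℓ₂(ε) = 4`, `k_n = ℚ₂(ζ_{2^{n+2}})⁺`,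
`d_n = G₂(ζ_{2^{n+2}} − 1)`; S3 is the Coleman norm relation `G₂(X)·G₂(−2−X) = G₂(X²+2X)`, i.e.
`N_{k_n/k_{n−1}} d_n = d_{n−1}` (`σ : ζ ↦ −ζ` generates `Gal(k_n/k_{n−1})` and acts on `X = ζ − 1`
by `X ↦ −2−X`; `X²+2X = ζ²−1`), proved by the refuter (§104) from `h(X) + h(−2−X) + 4 = h(X²+2X)`
for `h := ℓ₂ − log(1+X) = Σ_{k≥0} Σ_{δ=±1} ((1+X)^{2^kδ} − 1)/2^k`, then `exp` and `e⁴e⁴e^{−4} = e⁴`.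

## What is typed here, and how (the typer's FEASIBILITY NOTE, INBOX 2026-08-21T18:38Z)

`X ↦ −2−X` is NOT an algebraic substitution of formal power series (Mathlib `PowerSeries.HasSubst`
needs a nilpotent constant term), so the identity is typed in the UNIT VARIABLE `u = 1 + X`, where
`X ↦ −2−X` is `u ↦ −u` and `X ↦ X²+2X` is `u ↦ u²`. The `k`-th `δ`-paired summand of `h` is
`t_k(u) = (u^{2^k} + u^{−2^k} − 2)/2^k = (u^{2^k} − 1)²/(2^k u^{2^k})` (`kobTerm`), the truncation
`h_K(u) = Σ_{k<K} t_k(u)` (`kobLog`) makes sense for EVERY unit of EVERY commutative ring with `½`,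
and S3 at every finite level is the EXACT identity **`h_{K+1}(u) + h_{K+1}(−u) + 4 = h_K(u²)`**
(`kobLog_succ_add_kobLog_succ_neg`; the `k = 0` terms give `−4`, the `k ≥ 1` terms of `u`, `−u`
coincide, `2·t_{k+1}(u) = t_k(u²)`). Specialisations, all PROVED: (§3) `u = 1 + X ∈ A⟦X⟧ˣ`,
`−u = 1 + (−2−X)`, `u² = 1 + (X²+2X)`: the truncated series identity verbatim; (§2) THE EVALUATION
DICTIONARY `u = ζ`, `ζ^{2^{n+1}} = −1` ("`ζ_{2^{n+2}}`", layer `k_n`): the `k`-sum is FINITE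
(`t_k(ζ) = 0` for `k ≥ n+2`), `h(ζ−1) = h_{n+2}(ζ)` with closed form `h_{n+2}(ζ) + 4 = Σ_{k<n}
(ζ^{2^k} + ζ^{−2^k})/2^k` = (G19.2)'s `log₂ d_n = Σ_{j<n} 2^{−j}(ζ_{2^{n+2−j}} + ζ_{2^{n+2−j}}^{−1})`
once `log₂ d_n = ℓ₂(ε) + h(ζ−1)`, `ℓ₂(ε) = 4` are substituted; `h(i−1) = −4` (refuter (k3):
`log₂ d_0 = 0`), `h(ζ₈−1) + 4 = ζ₈ + ζ₈^{−1}` with square `2` (refuter (k1): `log₂ d_1 = √2`); and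
the TRACE RELATION `h(ζ−1) + h(σζ−1) + 4 = h(ζ²−1)` (`kobLog_torsion_trace`) = Kobayashi's "trace
compatibility … by direct calculations" at `p = 2`, whence `N_{k_n/k_{n−1}} d_n = ±d_{n−1}`.
NOT typed (per the refuter's vacuity caveat, said plainly): (a) the `2`-adic LIMIT `h ∈ ℚ₂⟦X⟧`
(coefficientwise: `[X^m] t_k(1+X)` has valuation `≥ k − 2⌊log₂ m⌋`; `[X²] h_K(1+X) = 2^K − 1 → −1`,
refuter (k4)) and `G₂ := e⁴·exp(h)` — definable (`PowerSeries.exp`/`subst`), not needed here;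
(b) `G₂ ∈ ℤ₂⟦X⟧^×` — lens-3's Honda/Hazewinkel IMPORT ([Kobayashi 2006, p. 569]), not re-derived;
(c) the multiplicative form and the SIGN `N d_n = +d_{n−1}` — only `exp`-bookkeeping + (b) beyond
the additive identity, and typing them needs the analytic re-expansion `X ↦ −2−X` (size L);
(d) `U¹_n`, Prop. 2.1 (ii)₂, Prop. 2.2₂, §3–§4 of the source. No `∃` over "a norm-coherent system".

References: [Kobayashi2006DocMath] §2 pp. 568–569 (ℓ, `log_p d_n`, Prop. 2.1 (i)); lens-3 GEN 19
(G19.2), (G19.3), (G19.8); o1 refuter v14b §104 (S3 exact proof, (k1), (k3), (k4)).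
-/

set_option autoImplicit false

namespace Summit.BirchSwinnertonDyer.Rank1Residual.X5.O1

namespace KobayashiTwo

/-! ## §1. Kobayashi's logarithm at `p = 2` in the unit variable, and S3 at every finite level -/

section UnitLanguage

variable {R : Type*} [CommRing R] [Invertible (2 : R)]

/-- **The `k`-th `δ`-paired summand of Kobayashi's logarithm at `p = 2`, in the unit variable
`u = 1 + X`**: `t_k(u) := (u^{2^k} + u^{−2^k} − 2)/2^k = Σ_{δ = ±1} (u^{2^k δ} − 1)/2^k` — the
`k`-th term of `h = ℓ₂ − log(1+X)`, `ℓ₂` = [Kobayashi 2006, §2 p. 568] `ℓ` with `p = 2`,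
`Δ = {±1}` (lens-3 GEN 19 (G19.2); refuter §104). Defined for every unit of every commutative ring
in which `2` is invertible; `u^{−2^k}` is `(u⁻¹)^{2^k}`. [cite: Kobayashi2006DocMath, §2 p. 568] -/
def kobTerm (u : Rˣ) (k : ℕ) : R :=
  ⅟(2 : R) ^ k * ((u : R) ^ 2 ^ k + ((u⁻¹ : Rˣ) : R) ^ 2 ^ k - 2)

/-- **The level-`K` truncation of Kobayashi's logarithm at `p = 2` in the unit variable**:
`h_K(u) := Σ_{k<K} t_k(u)`; `h = ℓ₂ − log(1+X)` is its `2`-adic coefficientwise limit at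
`u = 1 + X` (not taken in this file), and at a `2`-power torsion unit the sum is finite
(`kobLog_eq_kobLog_of_le`). [cite: Kobayashi2006DocMath, §2 p. 568] -/
def kobLog (K : ℕ) (u : Rˣ) : R :=
  ∑ k ∈ Finset.range K, kobTerm u k

omit [Invertible (2 : R)] in
/-- `(−u)⁻¹ = −u⁻¹` as ring elements. [folklore] -/
theorem val_inv_neg (u : Rˣ) : (((-u)⁻¹ : Rˣ) : R) = -((u⁻¹ : Rˣ) : R) := by
  have h : (-u)⁻¹ = -u⁻¹ := inv_eq_of_mul_eq_one_right (by rw [neg_mul_neg, mul_inv_cancel])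
  rw [h, Units.val_neg]

omit [Invertible (2 : R)] in
/-- `(u²)⁻¹ = (u⁻¹)²` as ring elements. [folklore] -/
theorem val_inv_sq (u : Rˣ) : (((u ^ 2)⁻¹ : Rˣ) : R) = ((u⁻¹ : Rˣ) : R) ^ 2 := by
  rw [← inv_pow, Units.val_pow_eq_pow_val]

/-- `t_k` in product form `t_k(u) = (u^{2^k} − 1)²·u^{−2^k}/2^k` (where the `2`-adic and `X`-adic
smallness of the summands is visible). [folklore] -/
theorem kobTerm_eq_sq_mul (u : Rˣ) (k : ℕ) :
    kobTerm u k = ⅟(2 : R) ^ k * (((u : R) ^ 2 ^ k - 1) ^ 2 * ((u⁻¹ : Rˣ) : R) ^ 2 ^ k) := by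
  have hu : (u : R) * ((u⁻¹ : Rˣ) : R) = 1 := by
    rw [← Units.val_mul, mul_inv_cancel, Units.val_one]
  have hk : (u : R) ^ 2 ^ k * ((u⁻¹ : Rˣ) : R) ^ 2 ^ k = 1 := by rw [← mul_pow, hu, one_pow]
  unfold kobTerm
  congr 1
  linear_combination (-(u : R) ^ 2 ^ k + 2) * hk

/-- The `k = 0` terms of `u` and `−u` add up to `−4`:
`(u + u⁻¹ − 2) + (−u − u⁻¹ − 2) = −4` (refuter §104, the `k = 0` line). [folklore] -/
theorem kobTerm_zero_add_kobTerm_neg_zero (u : Rˣ) : kobTerm u 0 + kobTerm (-u) 0 = -4 := by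
  simp only [kobTerm, pow_zero, pow_one, one_mul, val_inv_neg, Units.val_neg]
  ring

/-- For `k ≥ 1` the terms of `u` and `−u` coincide: `(−u)^{2^{k+1}} = u^{2^{k+1}}`
(refuter §104: "for `k ≥ 1`, `(−(1+X))^{2^kδ} = (1+X)^{2^kδ}`"). [folklore] -/
theorem kobTerm_neg_succ (u : Rˣ) (k : ℕ) : kobTerm (-u) (k + 1) = kobTerm u (k + 1) := by
  have he : Even (2 ^ (k + 1)) := (Nat.even_pow).2 ⟨even_two, Nat.succ_ne_zero k⟩
  simp only [kobTerm, val_inv_neg, Units.val_neg, he.neg_pow]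

/-- The doubling rule `2 · t_{k+1}(u) = t_k(u²)` (refuter §104: "their sum `2·Σ_δ((1+X)^{2^kδ} −
1)/2^k` is the `(k−1)`-th term of `h(X²+2X)`"). [folklore] -/
theorem two_mul_kobTerm_succ (u : Rˣ) (k : ℕ) : 2 * kobTerm u (k + 1) = kobTerm (u ^ 2) k := by
  have h2 : (2 : R) * ⅟(2 : R) ^ (k + 1) = ⅟(2 : R) ^ k := by
    rw [pow_succ, ← mul_assoc, mul_comm (2 : R), mul_assoc, mul_invOf_self, mul_one]
  simp only [kobTerm, val_inv_sq, Units.val_pow_eq_pow_val, ← pow_mul]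
  rw [← mul_assoc, h2, show 2 * 2 ^ k = 2 ^ (k + 1) from (pow_succ' 2 k).symm]

/-- **S3 at every finite level (the Coleman norm relation of Kobayashi's `2`-adic logarithm, in
the unit variable)**: `h_{K+1}(u) + h_{K+1}(−u) + 4 = h_K(u²)` for every unit `u` of every
commutative ring with `½`. At `u = 1 + X` this is `h_{K+1}(X) + h_{K+1}(−2−X) + 4 = h_K(X²+2X)`
(refuter §104's exact proof of lens-3 S3, finite level); at `u = ζ_{2^{n+2}}` it is the trace
relation of `(log₂ d_n)_n` ([Kobayashi 2006, Prop. 2.1 (i)] at `p = 2`). [folklore] -/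
theorem kobLog_succ_add_kobLog_succ_neg (K : ℕ) (u : Rˣ) :
    kobLog (K + 1) u + kobLog (K + 1) (-u) + 4 = kobLog K (u ^ 2) := by
  unfold kobLog
  rw [Finset.sum_range_succ' (fun k => kobTerm u k), Finset.sum_range_succ' (fun k => kobTerm (-u) k)]
  have h0 := kobTerm_zero_add_kobTerm_neg_zero u
  have hS : ∑ k ∈ Finset.range K, kobTerm u (k + 1) + ∑ k ∈ Finset.range K, kobTerm (-u) (k + 1) =
      ∑ k ∈ Finset.range K, kobTerm (u ^ 2) k := by
    rw [← Finset.sum_add_distrib]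
    refine Finset.sum_congr rfl fun k _ => ?_
    rw [kobTerm_neg_succ, ← two_mul, two_mul_kobTerm_succ]
  linear_combination h0 + hS

/-- `h_{K+1}(u) = h_K(u) + t_K(u)`. [folklore] -/
theorem kobLog_succ (K : ℕ) (u : Rˣ) : kobLog (K + 1) u = kobLog K u + kobTerm u K := by
  simp [kobLog, Finset.sum_range_succ]

end UnitLanguage

/-! ## §2. The evaluation dictionary: `2`-power torsion units (`u = ζ_{2^{n+2}}`, layer `k_n`) -/

section Torsion

variable {R : Type*} [CommRing R] [Invertible (2 : R)]

omit [Invertible (2 : R)] in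
/-- If `ζ^{2^{n+1}} = −1` then `ζ^{2^k} = 1` for every `k ≥ n + 2`. [folklore] -/
theorem pow_two_pow_eq_one_of_le {ζ : Rˣ} {n : ℕ} (hζ : ζ ^ 2 ^ (n + 1) = -1) {k : ℕ}
    (hk : n + 2 ≤ k) : ζ ^ 2 ^ k = 1 := by
  obtain ⟨j, rfl⟩ := Nat.exists_eq_add_of_le hk
  have he : Even (2 ^ (j + 1)) := (Nat.even_pow).2 ⟨even_two, Nat.succ_ne_zero j⟩
  rw [show n + 2 + j = (n + 1) + (j + 1) by ring, pow_add, pow_mul, hζ, he.neg_one_pow]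

/-- **Finiteness of the `k`-sum at a torsion unit**: if `ζ^{2^{n+1}} = −1` ("`ζ = ζ_{2^{n+2}}`")
then `t_k(ζ) = 0` for all `k ≥ n + 2`, so `h(ζ − 1)` is the FINITE sum `h_{n+2}(ζ)` — the `p = 2`
shape of the display `ℓ(ζ_{p^{n+1}} − 1) = Σ_{k=0}^{n} Σ_δ (ζ_{p^{n+1−k}}^δ − 1)/p^k` (one more term
at `p = 2`: `ζ^{2^{n+1}} = −1` still contributes, lens-3 (G19.2)). [cite: Kobayashi2006DocMath, §2 p. 569] -/
theorem kobTerm_eq_zero_of_le {ζ : Rˣ} {n : ℕ} (hζ : ζ ^ 2 ^ (n + 1) = -1) {k : ℕ}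
    (hk : n + 2 ≤ k) : kobTerm ζ k = 0 := by
  have h1 : ζ ^ 2 ^ k = 1 := pow_two_pow_eq_one_of_le hζ hk
  have h2 : (ζ⁻¹ : Rˣ) ^ 2 ^ k = 1 := by rw [inv_pow, h1, inv_one]
  simp only [kobTerm, ← Units.val_pow_eq_pow_val, h1, h2, Units.val_one]
  ring

/-- **`h(ζ − 1) = h_{n+2}(ζ)`**: for `ζ^{2^{n+1}} = −1` every truncation of level `K ≥ n + 2` equals
the level-`(n+2)` one. [cite: Kobayashi2006DocMath, §2 p. 569] -/
theorem kobLog_eq_kobLog_of_le {ζ : Rˣ} {n : ℕ} (hζ : ζ ^ 2 ^ (n + 1) = -1) {K : ℕ}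
    (hK : n + 2 ≤ K) : kobLog K ζ = kobLog (n + 2) ζ := by
  obtain ⟨j, rfl⟩ := Nat.exists_eq_add_of_le hK
  induction j with
  | zero => rfl
  | succ j ih =>
    rw [← add_assoc, kobLog_succ, ih (Nat.le_add_right _ _),
      kobTerm_eq_zero_of_le hζ (Nat.le_add_right _ _), add_zero]

omit [Invertible (2 : R)] in
/-- A unit of multiplicative order `4` (`w² = −1`) satisfies `w + w⁻¹ = 0`. [folklore] -/
theorem val_add_val_inv_eq_zero_of_sq {w : Rˣ} (hw : w ^ 2 = -1) :
    (w : R) + ((w⁻¹ : Rˣ) : R) = 0 := by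
  have h : w⁻¹ = -w := inv_eq_of_mul_eq_one_right (by rw [mul_neg, ← sq, hw, neg_neg])
  rw [h, Units.val_neg, add_neg_cancel]

/-- The geometric sum `Σ_{k<n} ⅟2^k = 2 − 2·⅟2^n` in any ring with `½`. [folklore] -/
theorem sum_invOf_two_pow (n : ℕ) :
    ∑ k ∈ Finset.range n, ⅟(2 : R) ^ k = 2 - 2 * ⅟(2 : R) ^ n := by
  induction n with
  | zero => simp
  | succ n ih =>
    rw [Finset.sum_range_succ, ih, pow_succ]
    linear_combination (⅟(2 : R) ^ n) * (mul_invOf_self (2 : R))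

/-- The two top terms at a torsion unit: for `ζ^{2^{n+1}} = −1`, `t_n(ζ) + t_{n+1}(ζ) = −4·⅟2^n`
(`ζ^{2^n}` has order `4`: `t_n(ζ) = −2/2^n`; `t_{n+1}(ζ) = (−1−1−2)/2^{n+1} = −2/2^n`). [folklore] -/
theorem kobTerm_add_kobTerm_succ_of_torsion {ζ : Rˣ} {n : ℕ} (hζ : ζ ^ 2 ^ (n + 1) = -1) :
    kobTerm ζ n + kobTerm ζ (n + 1) = -4 * ⅟(2 : R) ^ n := by
  have hw : (ζ ^ 2 ^ n) ^ 2 = -1 := by rw [← pow_mul, ← pow_succ, hζ]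
  have h0 : (ζ : R) ^ 2 ^ n + ((ζ⁻¹ : Rˣ) : R) ^ 2 ^ n = 0 := by
    have := val_add_val_inv_eq_zero_of_sq hw
    rwa [← inv_pow, Units.val_pow_eq_pow_val, Units.val_pow_eq_pow_val] at this
  have h1 : (ζ : R) ^ 2 ^ (n + 1) = -1 := by
    rw [← Units.val_pow_eq_pow_val, hζ, Units.val_neg, Units.val_one]
  have hk : (ζ : R) ^ 2 ^ (n + 1) * ((ζ⁻¹ : Rˣ) : R) ^ 2 ^ (n + 1) = 1 := by
    rw [← mul_pow, ← Units.val_mul, mul_inv_cancel, Units.val_one, one_pow]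
  have h2 : ((ζ⁻¹ : Rˣ) : R) ^ 2 ^ (n + 1) = -1 := by
    linear_combination (-1 : R) * hk + (((ζ⁻¹ : Rˣ) : R) ^ 2 ^ (n + 1)) * h1
  have h3 : ⅟(2 : R) ^ (n + 1) * 4 = 2 * ⅟(2 : R) ^ n := by
    rw [pow_succ, show (4 : R) = 2 * 2 by norm_num]
    linear_combination (2 * ⅟(2 : R) ^ n) * (invOf_mul_self (2 : R))
  unfold kobTerm
  linear_combination (⅟(2 : R) ^ n) * h0 + (⅟(2 : R) ^ (n + 1)) * h1 +
    (⅟(2 : R) ^ (n + 1)) * h2 - h3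

/-- **The closed form at layer `n` ("`log₂ d_n`")**: for a unit `ζ` with `ζ^{2^{n+1}} = −1`,
`h_{n+2}(ζ) + 4 = Σ_{k<n} (ζ^{2^k} + ζ^{−2^k})/2^k`. With `log₂ d_n = ℓ₂(ε) + h(ζ_{2^{n+2}} − 1)`
and `ℓ₂(ε) = 4` this is lens-3 (G19.2)'s `log₂ d_n = Σ_{j=0}^{n−1} 2^{−j}(ζ_{2^{n+2−j}} +
ζ_{2^{n+2−j}}^{−1})` (`ζ^{2^j} = ζ_{2^{n+2−j}}`), the `p = 2` reading of the display
`log_p(d_n) = p + Σ_{k=0}^{n} Σ_δ (ζ_{p^{n+1−k}}^δ − 1)/p^k` of [Kobayashi 2006, §2 p. 569].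
[cite: Kobayashi2006DocMath, §2 p. 569] -/
theorem kobLog_torsion_closed_form {ζ : Rˣ} {n : ℕ} (hζ : ζ ^ 2 ^ (n + 1) = -1) :
    kobLog (n + 2) ζ + 4 =
      ∑ k ∈ Finset.range n, ⅟(2 : R) ^ k * ((ζ : R) ^ 2 ^ k + ((ζ⁻¹ : Rˣ) : R) ^ 2 ^ k) := by
  have htop := kobTerm_add_kobTerm_succ_of_torsion hζ
  have hgeom := sum_invOf_two_pow (R := R) n
  have hsplit : kobLog (n + 2) ζ = kobLog n ζ + (kobTerm ζ n + kobTerm ζ (n + 1)) := by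
    rw [kobLog_succ, kobLog_succ, add_assoc]
  have hlow : kobLog n ζ =
      ∑ k ∈ Finset.range n, ⅟(2 : R) ^ k * ((ζ : R) ^ 2 ^ k + ((ζ⁻¹ : Rˣ) : R) ^ 2 ^ k) -
        2 * ∑ k ∈ Finset.range n, ⅟(2 : R) ^ k := by
    rw [kobLog, Finset.mul_sum, ← Finset.sum_sub_distrib]
    refine Finset.sum_congr rfl fun k _ => ?_
    unfold kobTerm
    ring
  rw [hsplit, hlow, htop, hgeom]
  ring

/-- **Layer `0` ("`d_0`", `ζ = ζ₄`, `ζ² = −1`)**: `h(ζ₄ − 1) = h_2(ζ₄) = −4`, so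
`log₂ d_0 = ℓ₂(ε) − 4 = 0` — refuter §104 (k3), lens-3 S1 (`d_0 ∈ {±1}`; the printed odd-`p`
statement is `d_0 = 1`, [Kobayashi 2006, Prop. 2.1 (i)]). [cite: Kobayashi2006DocMath, Prop. 2.1 (i)] -/
theorem kobLog_two_of_sq_eq_neg_one {ζ : Rˣ} (hζ : ζ ^ 2 = -1) : kobLog 2 ζ = -4 := by
  have h := kobLog_torsion_closed_form (n := 0) (ζ := ζ) (by simpa using hζ)
  simp only [Finset.range_zero, Finset.sum_empty] at h
  linear_combination h

/-- **Layer `1` ("`d_1`", `ζ = ζ₈`, `ζ⁴ = −1`)**: `h(ζ₈ − 1) + 4 = h_3(ζ₈) + 4 = ζ₈ + ζ₈^{−1}`, so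
`log₂ d_1 = ζ₈ + ζ₈^{−1}` — refuter §104 (k1) ("`log₂ d_1 = √2`"; see `sq_eq_two_of_pow_four`).
[cite: Kobayashi2006DocMath, §2 p. 569] -/
theorem kobLog_three_of_pow_four_eq_neg_one {ζ : Rˣ} (hζ : ζ ^ 4 = -1) :
    kobLog 3 ζ + 4 = (ζ : R) + ((ζ⁻¹ : Rˣ) : R) := by
  have h := kobLog_torsion_closed_form (n := 1) (ζ := ζ) (by simpa using hζ)
  simpa using h

omit [Invertible (2 : R)] in
/-- For `ζ⁴ = −1` the element `ζ + ζ⁻¹` squares to `2` (refuter (k1): `log₂ d_1 = √2`, of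
`2`-adic valuation `½` in `k_1 = ℚ₂(√2)`). [folklore] -/
theorem sq_eq_two_of_pow_four {ζ : Rˣ} (hζ : ζ ^ 4 = -1) :
    ((ζ : R) + ((ζ⁻¹ : Rˣ) : R)) ^ 2 = 2 := by
  have hw : (ζ ^ 2) ^ 2 = -1 := by rw [← pow_mul]; exact hζ
  have h0 := val_add_val_inv_eq_zero_of_sq hw
  rw [val_inv_sq, Units.val_pow_eq_pow_val] at h0
  have hu : (ζ : R) * ((ζ⁻¹ : Rˣ) : R) = 1 := by
    rw [← Units.val_mul, mul_inv_cancel, Units.val_one]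
  linear_combination h0 + 2 * hu

omit [Invertible (2 : R)] in
/-- In the tower: if `ζ^{2^{n+2}} = −1` (layer `n+1`) then `(−ζ)^{2^{n+2}} = −1` (`−ζ = σζ`, same
layer) and `(ζ²)^{2^{n+1}} = −1` (one layer down). [folklore] -/
theorem torsion_neg_and_sq {ζ : Rˣ} {n : ℕ} (hζ : ζ ^ 2 ^ (n + 2) = -1) :
    (-ζ) ^ 2 ^ (n + 2) = -1 ∧ (ζ ^ 2) ^ 2 ^ (n + 1) = -1 := by
  have he : Even (2 ^ (n + 2)) := (Nat.even_pow).2 ⟨even_two, Nat.succ_ne_zero _⟩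
  refine ⟨by rw [he.neg_pow, hζ], ?_⟩
  rw [← pow_mul, ← pow_succ', hζ]

/-- **The trace relation in the tower (Prop. 2.1 (i) at `p = 2`)**: for `ζ^{2^{n+2}} = −1` (layer
`n+1`, Galois conjugate `σζ = −ζ` over layer `n`, where `ζ²` lives),
`h(ζ − 1) + h(σζ − 1) + 4 = h(ζ² − 1)`, i.e. with `log₂ d_m = 4 + h(ζ_{2^{m+2}} − 1)`:
`log₂ d_{n+1} + log₂ d_{n+1}^σ = log₂ d_n` — [Kobayashi 2006, Prop. 2.1 (i)] "the trace
compatibility of `(log_p(d_n))_n` … by direct calculations", whence `N d_{n+1} = ± d_n`; the sign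
`+` is lens-3's S3 via the Coleman series `G₂` (NOT typed here). The three values are the finite
stable ones: ANY truncation levels `K ≥ n + 3` (for `ζ`, `−ζ`) and `K' ≥ n + 2` (for `ζ²`) give
the same numbers (`kobLog_eq_kobLog_of_le`, `torsion_neg_and_sq`). [cite: Kobayashi2006DocMath, Prop. 2.1 (i)] -/
theorem kobLog_torsion_trace {ζ : Rˣ} {n : ℕ} (hζ : ζ ^ 2 ^ (n + 2) = -1) {K K' : ℕ}
    (hK : n + 3 ≤ K) (hK' : n + 2 ≤ K') :
    kobLog K ζ + kobLog K (-ζ) + 4 = kobLog K' (ζ ^ 2) := by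
  obtain ⟨hneg, hsq⟩ := torsion_neg_and_sq hζ
  rw [kobLog_eq_kobLog_of_le hζ hK, kobLog_eq_kobLog_of_le hneg hK,
    kobLog_eq_kobLog_of_le hsq hK']
  exact kobLog_succ_add_kobLog_succ_neg (n + 2) ζ

/-- The closed form at ANY truncation level `K ≥ n + 2` (the stable value `h(ζ − 1)`): for
`ζ^{2^{n+1}} = −1`, `h_K(ζ) + 4 = Σ_{k<n} (ζ^{2^k} + ζ^{−2^k})/2^k` ("`= log₂ d_n`", lens-3
(G19.2)). [cite: Kobayashi2006DocMath, §2 p. 569] -/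
theorem kobLog_add_four_eq_of_torsion {ζ : Rˣ} {n : ℕ} (hζ : ζ ^ 2 ^ (n + 1) = -1) {K : ℕ}
    (hK : n + 2 ≤ K) :
    kobLog K ζ + 4 =
      ∑ k ∈ Finset.range n, ⅟(2 : R) ^ k * ((ζ : R) ^ 2 ^ k + ((ζ⁻¹ : Rˣ) : R) ^ 2 ^ k) := by
  rw [kobLog_eq_kobLog_of_le hζ hK]
  exact kobLog_torsion_closed_form hζ

end Torsion

/-! ## §3. The power-series instance `u = 1 + X` -/

section Series

open PowerSeries

variable (A : Type*) [CommRing A]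

/-- **The unit `1 + X` of `A⟦X⟧`** (inverse `1 − X + X² − ⋯`, Mathlib `PowerSeries.invOfUnit`).
[folklore] -/
noncomputable def onePlusX : (A⟦X⟧)ˣ :=
  Units.mkOfMulEqOne (1 + X) (PowerSeries.invOfUnit (1 + X) 1)
    (PowerSeries.mul_invOfUnit (1 + X) 1 (by simp))

/-- `onePlusX` is `1 + X`. [folklore] -/
@[simp] theorem val_onePlusX : ((onePlusX A : (A⟦X⟧)ˣ) : A⟦X⟧) = 1 + X := rfl

/-- The dictionary, part 1: `−(1 + X) = 1 + (−2 − X)` — the unit `1 + X` after `X ↦ −2 − X`.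
[folklore] -/
theorem val_neg_onePlusX : ((-onePlusX A : (A⟦X⟧)ˣ) : A⟦X⟧) = 1 + (-2 - X) := by
  rw [Units.val_neg, val_onePlusX]; ring

/-- The dictionary, part 2: `(1 + X)² = 1 + (X² + 2X)` — the unit `1 + X` after `X ↦ X² + 2X`.
[folklore] -/
theorem val_onePlusX_sq : ((onePlusX A ^ 2 : (A⟦X⟧)ˣ) : A⟦X⟧) = 1 + (X ^ 2 + 2 * X) := by
  rw [Units.val_pow_eq_pow_val, val_onePlusX]; ring

/- `2` invertible in `A⟦X⟧` (equivalently in `A`; e.g. `A = ℚ`, `ℤ[½]`, `ℚ₂`, where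
`(Invertible.map PowerSeries.C 2).copy 2 (map_ofNat _ 2).symm` is an instance term) is taken as a
hypothesis: no instance is declared in this file. -/
variable [Invertible (2 : A⟦X⟧)]

/-- **S3 for the truncated power series**: with `h_K(X) := h_K(1 + X) ∈ A⟦X⟧`
(`kobLog K (onePlusX A)`), `h_{K+1}(X) + h_{K+1}(−2−X) + 4 = h_K(X² + 2X)`, where
`h_{K+1}(−2−X)` and `h_K(X²+2X)` are the unit-variable values at `−(1+X) = 1 + (−2−X)` and
`(1+X)² = 1 + (X²+2X)` (`val_neg_onePlusX`, `val_onePlusX_sq`) — refuter §104's identity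
`h(X) + h(−2−X) + 4 = h(X²+2X)` at every finite level, for every coefficient ring with `½`
(e.g. `ℚ`, `ℤ[½]`, `ℚ₂`). [folklore] -/
theorem kobLog_onePlusX_norm_relation (K : ℕ) :
    kobLog (K + 1) (onePlusX A) + kobLog (K + 1) (-onePlusX A) + 4 =
      kobLog K (onePlusX A ^ 2) :=
  kobLog_succ_add_kobLog_succ_neg K (onePlusX A)

/-- `h_K(X)` has zero constant term (`h(0) = 0`, [Kobayashi 2006, §2 p. 569 "`ℓ(0) = 0`"]).
[cite: Kobayashi2006DocMath, §2 p. 569] -/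
theorem constantCoeff_kobLog_onePlusX (K : ℕ) :
    PowerSeries.constantCoeff (kobLog K (onePlusX A)) = 0 := by
  have hinv : PowerSeries.constantCoeff ((((onePlusX A)⁻¹ : (A⟦X⟧)ˣ)) : A⟦X⟧) = 1 := by
    have h := congrArg PowerSeries.constantCoeff
      (show ((onePlusX A : (A⟦X⟧)ˣ) : A⟦X⟧) * (((onePlusX A)⁻¹ : (A⟦X⟧)ˣ) : A⟦X⟧) = 1 by
        rw [← Units.val_mul, mul_inv_cancel, Units.val_one])
    simpa using h
  have hone : PowerSeries.constantCoeff ((onePlusX A : (A⟦X⟧)ˣ) : A⟦X⟧) = 1 := by simp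
  unfold kobLog
  rw [map_sum]
  refine Finset.sum_eq_zero fun k _ => ?_
  unfold kobTerm
  rw [map_mul, map_sub, map_add]
  simp only [map_pow, hone, hinv]
  rw [map_ofNat (PowerSeries.constantCoeff (R := A)) 2]
  ring

end Series

end KobayashiTwo

end Summit.BirchSwinnertonDyer.Rank1Residual.X5.O1
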